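import Summits.NavierStokesRegularity.NavierStokesRegularity.Theorems.PerpetualPumpEulerTypeIGlueDensity
import Summits.NavierStokesRegularity.NavierStokesRegularity.Theorems.PerpetualPumpEulerTypeIGlueSobolevR3
import Summits.NavierStokesRegularity.NavierStokesRegularity.Theorems.PerpetualPumpEulerTypeIGlueDuhamel
import Literature.Analysis.FluidPDE.NSCriticalClosureBesovKatoClass
import Literature.Analysis.FluidPDE.TaoMildSolutionBounds

/-!
# Route PerpetualPump · `EulerTypeIGlue` — stub `stub_continuity` (line `Sketch`)

For a classical Leray–Hopf solution `u` on `[0,T)` (from its rapidly decaying datum `u 0`) and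
the curve `U t = [(u t)^ℂ] ∈ L²(ℝ³;ℂ³)` of its complexified slices, `U ∈ C([0,T); H¹⁰)` in Tao's
sense (`ContinuousInH10On (Ico 0 T) U`).  No time derivative of the `L²` classes is used; the
proof is an interpolation on each closed slab `[0,T₁]`, `T₁ = (t₀+T)/2`:

* `u ∈ C([0,T₁]; L²)` (`continuousInLpOn_two_of_tao_local`, Tao 2013 Thm. 5.4 + weak–strong
  uniqueness, PROVED in the tree), and `‖U t - U t₀‖_{L²} = ‖u t - u t₀‖_{L²}`;
* `sup_{[0,T₁]} ‖U t‖_{H²⁰} < ∞`: all Sobolev norms of `u` are bounded on the closed slab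
  (`tao2011_hasBoundedSobolevNormsOn_holds`, Tao 2013 Cor. 11.1) and the physical → Fourier
  transfer `eFourierSobolevNorm_sq_le` (toolkit `SobolevR3`);
* the Fourier-side Cauchy–Schwarz interpolation `‖g‖²_{H¹⁰} ≤ ‖g‖_{L²} ‖g‖_{H²⁰}`
  (`eFourierSobolevNorm_ten_sq_le_enorm_mul`), whence
  `‖U t - U t₀‖_{H¹⁰} ≤ (2B ‖u t - u t₀‖_{L²})^{1/2} → 0` within `[0,T₁]`;
* localisation `𝓝[Ico 0 T] t₀ ≤ 𝓝[Icc 0 T₁] t₀` (as in `continuousInLpOn_of_forall_Icc`).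

## References

* T. Tao, *Localisation and compactness properties of the Navier–Stokes global regularity
  problem*, Anal. PDE 6 (2013), arXiv:1108.1165, Cor. 11.1, Thm. 5.4 (iv). [Tao2011]
* T. Tao, J. Amer. Math. Soc. 29 (2016), arXiv:1402.0290v3, §1.1 (1.15) (continuity into
  `H¹⁰_df`). [Tao2016AveragedNS]
-/

noncomputable section

open MeasureTheory Set Filter Topology FourierTransform
open scoped ENNReal NNReal RealInnerProductSpace SchwartzMap ContDiff

set_option linter.dupNamespace false

namespace Summit.NavierStokesRegularity.NavierStokesRegularity.Theorems.PerpetualPumpEulerTypeIGlue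

open Literature.Analysis.FluidPDE Literature.Analysis.FluidPDE.Tao2016
open Literature.Analysis.FunctionSpaces (eFourierSobolevNorm)
open Literature.Analysis.FunctionSpaces.EuclideanSpace (complexify complexify_apply norm_complexify
  continuous_complexify)

/-- Local notation for physical / frequency space `ℝ³`. -/
local notation "ℝ³" => EuclideanSpace ℝ (Fin 3)
/-- Local notation for the complexified range `ℂ³`. -/
local notation "ℂ³" => EuclideanSpace ℂ (Fin 3)

/-! ### Fourier-side interpolation `‖g‖²_{H¹⁰} ≤ ‖g‖_{L²} ‖g‖_{H²⁰}` -/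

/-- The square of the Sobolev weight of order `10` is the weight of order `20`. [folklore] -/
theorem sobolevWeight_ten_sq {w : ℝ} (hw : 0 ≤ w) : (w ^ (10 : ℝ)) ^ 2 = w ^ (20 : ℝ) := by
  rw [← Real.rpow_natCast, ← Real.rpow_mul hw]
  norm_num

/-- `‖g‖²_{H^s}` is the weighted integral `∫ (1+|ξ|²)^s |ĝ|²`. [folklore] -/
theorem eFourierSobolevNorm_sq_eq_sobolevWeightIntegral (s : ℝ) (g : L2C) :
    eFourierSobolevNorm s g ^ 2 = sobolevWeightIntegral s (fourierFn g) := by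
  rw [eFourierSobolevNorm_eq, ← ENNReal.rpow_natCast, ← ENNReal.rpow_mul]
  norm_num

/-- `x = (x²)^{1/2}` in `ℝ≥0∞`. [folklore] -/
theorem ennreal_eq_sq_rpow_half (x : ℝ≥0∞) : x = (x ^ 2) ^ (1 / 2 : ℝ) := by
  rw [← ENNReal.rpow_natCast, ← ENNReal.rpow_mul]
  norm_num

/-- **Fourier-side interpolation** `‖g‖²_{H¹⁰} ≤ ‖g‖_{L²} ‖g‖_{H²⁰}` for `g ∈ L²(ℝ³;ℂ³)`:
Cauchy–Schwarz for the splitting `(1+|ξ|²)^{10}|ĝ|² = |ĝ| · ((1+|ξ|²)^{10}|ĝ|)` and Plancherel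
`‖g‖²_{L²} = ∫ |ĝ|²`. [folklore] -/
theorem eFourierSobolevNorm_ten_sq_le_enorm_mul (g : L2C) :
    eFourierSobolevNorm 10 g ^ 2 ≤ ‖g‖ₑ * eFourierSobolevNorm 20 g := by
  have hGm : AEMeasurable (fun ξ => ‖fourierFn g ξ‖ₑ) volume :=
    (aestronglyMeasurable_fourierFn g).enorm
  have hWm : AEMeasurable
      (fun ξ : ℝ³ => ENNReal.ofReal ((1 + ‖ξ‖ ^ 2) ^ (10 : ℝ)) * ‖fourierFn g ξ‖ₑ) volume :=
    (measurable_sobolevWeight 10).aemeasurable.mul hGm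
  have hH := ENNReal.lintegral_mul_le_Lp_mul_Lq volume Real.HolderConjugate.two_two hGm hWm
  simp only [Pi.mul_apply, ENNReal.rpow_two] at hH
  rw [eFourierSobolevNorm_sq_eq_sobolevWeightIntegral]
  unfold sobolevWeightIntegral
  calc ∫⁻ ξ, ENNReal.ofReal ((1 + ‖ξ‖ ^ 2) ^ (10 : ℝ)) * ‖fourierFn g ξ‖ₑ ^ 2
      = ∫⁻ ξ, ‖fourierFn g ξ‖ₑ * (ENNReal.ofReal ((1 + ‖ξ‖ ^ 2) ^ (10 : ℝ)) * ‖fourierFn g ξ‖ₑ) :=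
        lintegral_congr fun ξ => by ring
    _ ≤ (∫⁻ ξ, ‖fourierFn g ξ‖ₑ ^ 2) ^ (1 / 2 : ℝ) *
          (∫⁻ ξ, (ENNReal.ofReal ((1 + ‖ξ‖ ^ 2) ^ (10 : ℝ)) * ‖fourierFn g ξ‖ₑ) ^ 2) ^ (1 / 2 : ℝ) :=
        hH
    _ = ‖g‖ₑ * eFourierSobolevNorm 20 g := by
        congr 1
        · rw [← enorm_sq_eq_lintegral_fourierFn]
          exact (ennreal_eq_sq_rpow_half _).symm
        · rw [eFourierSobolevNorm_eq]
          unfold sobolevWeightIntegral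
          congr 1
          refine lintegral_congr fun ξ => ?_
          rw [mul_pow, ← ENNReal.ofReal_pow (by positivity), sobolevWeight_ten_sq (by positivity)]

/-! ### Uniform `H²⁰` bound of the complexified slices on a slab -/

/-- **Uniform `H²⁰` bound on a slab**: if all Sobolev norms of the smooth slices `u t`, `t ∈ S`,
are bounded (`HasBoundedSobolevNormsOn S u`) and `⇑(U t) = (u t)^ℂ` a.e., then
`sup_{t ∈ S} ‖U t‖_{H²⁰} < ∞` (physical → Fourier transfer `eFourierSobolevNorm_sq_le` with
`N = 20`). [cite: Tao2011, Cor. 11.1 + Thm. 5.4 (iv)] -/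
theorem exists_eFourierSobolevNorm_twenty_le {S : Set ℝ} {u : ℝ → ℝ³ → ℝ³} {U : ℝ → L2C}
    (hH : HasBoundedSobolevNormsOn S u) (hsm : ∀ t ∈ S, ContDiff ℝ (⊤ : ℕ∞) (u t))
    (hU : ∀ t ∈ S, ((U t : L2C) : ℝ³ → ℂ³) =ᵐ[volume] complexify ∘ u t) :
    ∃ B : ℝ≥0∞, B ≠ ⊤ ∧ ∀ t ∈ S, eFourierSobolevNorm 20 (U t) ≤ B := by
  obtain ⟨C₀, hC₀⟩ := hH 0
  obtain ⟨C₂₀, hC₂₀⟩ := hH 20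
  refine ⟨(2 ^ 20 * ((C₀ : ℝ≥0∞) + 3 ^ 20 * C₂₀)) ^ (1 / 2 : ℝ),
    ENNReal.rpow_ne_top_of_nonneg (by norm_num) (ENNReal.mul_ne_top (by simp)
      (ENNReal.add_ne_top.2 ⟨ENNReal.coe_ne_top, ENNReal.mul_ne_top (by simp) ENNReal.coe_ne_top⟩)),
    fun t ht => ?_⟩
  have hint : ∀ j, ∫⁻ x, ‖iteratedFDeriv ℝ j (u t) x‖ₑ ^ 2 < ⊤ := fun j => by
    obtain ⟨C, hC⟩ := hH j
    exact (hC t ht).trans_lt ENNReal.coe_lt_top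
  have h2 : MemLp (complexify ∘ u t) 2 (volume : Measure ℝ³) := (Lp.memLp (U t)).ae_eq (hU t ht)
  have hUeq : U t = h2.toLp _ := Lp.ext ((hU t ht).trans h2.coeFn_toLp.symm)
  have h := eFourierSobolevNorm_sq_le (hsm t ht) 19 (fun j _ => hint j) h2
  simp only [Nat.reduceAdd, Nat.cast_ofNat] at h
  have h0 : ∫⁻ x, ‖u t x‖ₑ ^ 2 ≤ C₀ := by
    refine (le_of_eq (lintegral_congr fun x => ?_)).trans (hC₀ t ht)
    rw [← ofReal_norm, ← norm_iteratedFDeriv_zero (𝕜 := ℝ) (f := u t), ofReal_norm]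
  have hsq : eFourierSobolevNorm 20 (U t) ^ 2 ≤ 2 ^ 20 * ((C₀ : ℝ≥0∞) + 3 ^ 20 * C₂₀) := by
    rw [hUeq]
    exact h.trans (mul_le_mul_right (add_le_add h0 (mul_le_mul_right (hC₂₀ t ht) _)) _)
  calc eFourierSobolevNorm 20 (U t) = (eFourierSobolevNorm 20 (U t) ^ 2) ^ (1 / 2 : ℝ) :=
        ennreal_eq_sq_rpow_half _
    _ ≤ _ := ENNReal.rpow_le_rpow hsq (by norm_num)

/-! ### The `L²` distance of the complexified classes -/

/-- `‖[v^ℂ] - [w^ℂ]‖_{L²(ℝ³;ℂ³)} = ‖v - w‖_{L²(ℝ³;ℝ³)}` (complexification is an `ℝ`-linear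
isometry). [folklore] -/
theorem enorm_sub_eq_eLpNorm_sub_of_ae_eq_complexify {V W : L2C} {v w : ℝ³ → ℝ³}
    (hV : ((V : L2C) : ℝ³ → ℂ³) =ᵐ[volume] complexify ∘ v)
    (hW : ((W : L2C) : ℝ³ → ℂ³) =ᵐ[volume] complexify ∘ w) :
    ‖V - W‖ₑ = eLpNorm (v - w) 2 volume := by
  rw [Lp.enorm_def]
  refine eLpNorm_congr_norm_ae ?_
  filter_upwards [Lp.coeFn_sub V W, hV, hW] with x hx h1 h2
  rw [hx, Pi.sub_apply, h1, h2, Function.comp_apply, Function.comp_apply, ← complexify.map_sub,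
    norm_complexify, Pi.sub_apply]

/-! ### The stub -/

/-- **S5 — continuity of `t ↦ U t` in `H¹⁰` on `[0,T)`** for the complexified curve
`U t = [(u t)^ℂ]` of a classical Leray–Hopf solution from a rapidly decaying datum: Fourier-side
interpolation `‖g‖²_{H¹⁰} ≤ ‖g‖_{L²} ‖g‖_{H²⁰}` between the slab facts `u ∈ C([0,T₁]; L²)`
(`continuousInLpOn_two_of_tao_local`) and `u ∈ L^∞([0,T₁]; H²⁰)`
(`tao2011_hasBoundedSobolevNormsOn_holds`, `eFourierSobolevNorm_sq_le`), `T₁ = (t₀+T)/2`.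
[cite: Tao2011, Cor. 11.1 + Thm. 5.4 (iv)] -/
theorem stub_continuity {ν T : ℝ} (hν : 0 < ν) (hT : 0 < T) {u : ℝ → ℝ³ → ℝ³} {p : ℝ → ℝ³ → ℝ}
    (hcl : IsClassicalNSSolutionOn (Ico 0 T) ν 0 u p) (hLH : IsLerayHopfOn T ν 0 (u 0) u)
    (hdec : HasRapidSpatialDecay (u 0)) (U : ℝ → L2C)
    (hU : ∀ t ∈ Ico 0 T, ((U t : L2C) : ℝ³ → ℂ³) =ᵐ[volume] complexify ∘ u t) :
    ContinuousInH10On (Ico 0 T) U := by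
  intro t₀ ht₀
  -- the closed slab `[0, T₁]`, `t₀ < T₁ < T`
  set T₁ : ℝ := (t₀ + T) / 2 with hT₁def
  have hT₁ : T₁ ∈ Ioo 0 T :=
    ⟨by rw [hT₁def]; linarith [ht₀.1, ht₀.2], by rw [hT₁def]; linarith [ht₀.2]⟩
  have ht₀T₁ : t₀ < T₁ := by rw [hT₁def]; linarith [ht₀.2]
  have hsub : Icc 0 T₁ ⊆ Ico 0 T := Icc_subset_Ico_right hT₁.2
  have ht₀' : t₀ ∈ Icc 0 T₁ := ⟨ht₀.1, ht₀T₁.le⟩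
  -- (a) `L²` continuity on the slab
  have hL2 : ContinuousInLpOn (Icc 0 T₁) 2 u :=
    continuousInLpOn_two_of_tao_local tao2011_smooth_local_existence_holds
      tao2011_hasBoundedSobolevNormsOn_holds hν hT hcl hLH hdec T₁ hT₁
  -- (b) all Sobolev norms are bounded on the slab; uniform `H²⁰` bound of `U`
  have hcl₁ : IsClassicalNSSolutionOn (Icc 0 T₁) ν 0 u p :=
    hcl.mono hsub (uniqueDiffOn_Icc hT₁.1)
  have hEn : ∃ C : ℝ≥0∞, C < ⊤ ∧ ∀ t ∈ Icc 0 T₁, ∫⁻ x, ‖u t x‖ₑ ^ 2 ≤ C :=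
    ⟨ENNReal.ofReal (2 * VectorCalculus.kineticEnergy (u 0)), ENNReal.ofReal_lt_top, fun t ht =>
      hLH.lintegral_enorm_sq_le hν.le ⟨ht.1, ht.2.trans hT₁.2.le⟩⟩
  have hH : HasBoundedSobolevNormsOn (Icc 0 T₁) u :=
    (tao2011_hasBoundedSobolevNormsOn.closedSlab tao2011_hasBoundedSobolevNormsOn_holds
      linfty_bound_of_hasBoundedSobolevNormsOn_holds ν T₁ hν hT₁.1 u p hcl₁ hEn hdec).1
  obtain ⟨B, hBtop, hB⟩ := exists_eFourierSobolevNorm_twenty_le hH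
    (fun t ht => hcl₁.contDiff_velocity ht) (fun t ht => hU t (hsub ht))
  -- (c) interpolation: `‖U t - U t₀‖_{H¹⁰} ≤ (2B ‖u t - u t₀‖_{L²})^{1/2}` on the slab
  have hbd : ∀ t ∈ Icc 0 T₁, eFourierSobolevNorm 10 (U t - U t₀) ≤
      ((B + B) * eLpNorm (u t - u t₀) 2 volume) ^ (1 / 2 : ℝ) := by
    intro t ht
    have h20 : eFourierSobolevNorm 20 (U t - U t₀) ≤ B + B := by
      calc eFourierSobolevNorm 20 (U t - U t₀)
          ≤ eFourierSobolevNorm 20 (U t) + eFourierSobolevNorm 20 (-U t₀) := by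
            rw [sub_eq_add_neg]
            exact eFourierSobolevNorm_add_le _ _ _
        _ = eFourierSobolevNorm 20 (U t) + eFourierSobolevNorm 20 (U t₀) := by
            rw [eFourierSobolevNorm_neg]
        _ ≤ B + B := add_le_add (hB t ht) (hB t₀ ht₀')
    have hsq : eFourierSobolevNorm 10 (U t - U t₀) ^ 2 ≤ (B + B) * eLpNorm (u t - u t₀) 2 volume := by
      calc eFourierSobolevNorm 10 (U t - U t₀) ^ 2
          ≤ ‖U t - U t₀‖ₑ * eFourierSobolevNorm 20 (U t - U t₀) :=
            eFourierSobolevNorm_ten_sq_le_enorm_mul _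
        _ ≤ ‖U t - U t₀‖ₑ * (B + B) := mul_le_mul_right h20 _
        _ = (B + B) * eLpNorm (u t - u t₀) 2 volume := by
            rw [enorm_sub_eq_eLpNorm_sub_of_ae_eq_complexify (hU t (hsub ht)) (hU t₀ (hsub ht₀')),
              mul_comm]
    calc eFourierSobolevNorm 10 (U t - U t₀)
        = (eFourierSobolevNorm 10 (U t - U t₀) ^ 2) ^ (1 / 2 : ℝ) := ennreal_eq_sq_rpow_half _
      _ ≤ _ := ENNReal.rpow_le_rpow hsq (by norm_num)
  -- (d) the limit within the slab
  have hlim : Tendsto (fun t => ((B + B) * eLpNorm (u t - u t₀) 2 volume) ^ (1 / 2 : ℝ))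
      (𝓝[Icc 0 T₁] t₀) (𝓝 0) := by
    have h3 : Tendsto (fun t => (B + B) * eLpNorm (u t - u t₀) 2 volume) (𝓝[Icc 0 T₁] t₀) (𝓝 0) := by
      have h := ENNReal.Tendsto.const_mul (a := B + B) (hL2.2 t₀ ht₀')
        (Or.inr (ENNReal.add_ne_top.2 ⟨hBtop, hBtop⟩))
      rwa [mul_zero] at h
    have h4 := ((ENNReal.continuous_rpow_const (y := 1 / 2)).tendsto 0).comp h3
    rwa [ENNReal.zero_rpow_of_pos (by norm_num)] at h4
  have hslab : Tendsto (fun t => eFourierSobolevNorm 10 (U t - U t₀)) (𝓝[Icc 0 T₁] t₀) (𝓝 0) := by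
    refine tendsto_of_tendsto_of_tendsto_of_le_of_le' tendsto_const_nhds hlim
      (Eventually.of_forall fun _ => bot_le) ?_
    filter_upwards [self_mem_nhdsWithin] with t ht using hbd t ht
  -- (e) localise: `𝓝[Ico 0 T] t₀ ≤ 𝓝[Icc 0 T₁] t₀`
  refine hslab.mono_left ?_
  have hmem : Iio T₁ ∈ 𝓝[Ico 0 T] t₀ := mem_nhdsWithin_of_mem_nhds (Iio_mem_nhds ht₀T₁)
  rw [← nhdsWithin_inter_of_mem hmem]
  exact nhdsWithin_mono _ fun t ht => ⟨ht.2.1, (mem_Iio.1 ht.1).le⟩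

end Summit.NavierStokesRegularity.NavierStokesRegularity.Theorems.PerpetualPumpEulerTypeIGlue

end
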